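import Summits.ResolutionOfSingularities.ResolutionOfSingularities.Theorems.ValuativeLuAlphaPTorsorRankOneAssembly
import Summits.ResolutionOfSingularities.ResolutionOfSingularities.Theorems.ValuativeLuAlphaPTorsorBirationalExit
import Summits.ResolutionOfSingularities.ResolutionOfSingularities.Theorems.ValuativeLuAlphaPTorsorHenselRootChart
import Summits.ResolutionOfSingularities.ResolutionOfSingularities.Theorems.ValuativeLuAlphaPTorsorPerronMonomialization
import Summits.ResolutionOfSingularities.ResolutionOfSingularities.Theorems.ValuativeLuAlphaPTorsorValueStep
import Summits.ResolutionOfSingularities.ResolutionOfSingularities.Theorems.ValuativeLuAlphaPTorsorResidueStep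
import HarnessLib

/-!
# `LuAlphaPTorsor` along zero-dimensional rank-one Abhyankar places: absorption and conclusion (S6 `stub_rankOneAbhyankar`)

Crux `Valuative.LuAlphaPTorsor` (item `stmt-ResolutionOfSingularities-0641`), line
`pfaff-line-log-final-forms`, reshape v6 (lead seat c4), assembly S6, last part: from a very good
chart `(R, x)` of `K` (`exists_chart_top`), absorb the finitely many generators of `A₀` and `t`
(Perron monomialization S3 applied to numerators and denominators, then once more to make the
exponent differences non-negative; the unit parts inverted by `exists_chart_adjoin_inv`), and
conclude: `A := R'` contains `A₀[t]`, has `Frac A = K`, and is regular at the centre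
(`isRegularLocalRing_of_chart`: the centre is generated by `n = trdeg_k K` elements). Modulo the
registered stubs S2–S5 (hypotheses, verbatim statements): `rankOneAbhyankar_of_stubs`.
-/

set_option linter.dupNamespace false

open IsLocalRing

namespace Summit.ResolutionOfSingularities.ResolutionOfSingularities.Theorems.PfaffLine

open Literature.AlgebraicGeometry.Resolution

variable {k K : Type} [Field k] [Field K] [Algebra k K]

section Stubs

variable
  (hS3 : ∀ (k K : Type) [Field k] [Field K] [Algebra k K] (O : ValuationSubring K) (n : ℕ) (R : Subalgebra k K) (hRO : R.toSubring ≤ O.toSubring) (x : Fin n → K) (hx : ∀ i, x i ∈ R), R.FG → (∀ i, x i ≠ 0) → Ideal.span (Set.range fun i => (⟨x i, hx i⟩ : R.toSubring)) = Ideal.comap (Subring.inclusion hRO) (IsLocalRing.maximalIdeal O) → (∀ m : Fin n → ℤ, (∏ i, O.valuation (x i) ^ (m i)) = 1 → m = 0) → (∀ z w : K, O.valuation z < 1 → w ≠ 0 → ∃ N : ℕ, O.valuation z ^ N < O.valuation w) → ∀ (m : ℕ) (a : Fin m → K), (∀ j, a j ∈ R ∧ a j ≠ 0) → ∀ (l :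 ℕ) (h : Fin l → Fin n → ℤ), (∀ j, (∏ i, O.valuation (x i) ^ (h j i)) ≤ 1) → ∃ (R' : Subalgebra k K) (hR'O : R'.toSubring ≤ O.toSubring) (x' : Fin n → K) (hx' : ∀ i, x' i ∈ R'), R ≤ R' ∧ R'.FG ∧ ((R' : Set K) ⊆ Subfield.closure (R : Set K)) ∧ (∀ i, x' i ≠ 0) ∧ Ideal.span (Set.range fun i => (⟨x' i, hx' i⟩ : R'.toSubring)) = Ideal.comap (Subring.inclusion hR'O) (IsLocalRing.maximalIdeal O) ∧ (∀ m : Fin n → ℤ, (∏ i, O.valuation (x' i) ^ (m i)) = 1 → m = 0) ∧ (∀ i, ∃ d : Fin n → ℕ, x i = ∏ j, x' j ^ (d j)) ∧ (∀ j, ∃ (α : Fin n → ℕ) (u : K), u ∈ R' ∧ O.valuation u = 1 ∧ a j = (∏ i, x' i ^ (α i)) * u) ∧ (∀ j, ∃ e : Fin n → ℕ, (∏ i, x i ^ (h j i)) = ∏ i, x' i ^ (e i)))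

include hS3

/-! ### Absorbing finitely many elements of `O` -/

/-- **Absorption.** Given a very good chart `(R, x)` of `K` along the rank-one `O` (`K = Frac R`)
and finitely many non-zero `a_j ∈ O`, there is a very good chart `(R', x')` of `K` with `R ≤ R'`
containing every `a_j`: monomialize the numerators and denominators of the `a_j` (S3), invert the
unit parts of the denominators, and monomialize the (non-negative in value) exponent differences
(S3 again). [folklore] -/
theorem exists_chart_absorbing (O : ValuationSubring K)
    (hr1 : ∀ z w : K, O.valuation z < 1 → w ≠ 0 → ∃ N : ℕ, O.valuation z ^ N < O.valuation w)
    {n : ℕ} (R : Subalgebra k K) (hRO : R.toSubring ≤ O.toSubring) (x : Fin n → K)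
    (hx : ∀ i, x i ∈ R) (hfg : R.FG) (hfrac : ∀ z : K, z ∈ Subfield.closure (R : Set K))
    (hx0 : ∀ i, x i ≠ 0)
    (hspan : Ideal.span (Set.range fun i => (⟨x i, hx i⟩ : R.toSubring)) =
      Ideal.comap (Subring.inclusion hRO) (maximalIdeal O))
    (hind : ∀ m : Fin n → ℤ, (∏ i, O.valuation (x i) ^ (m i)) = 1 → m = 0)
    {m : ℕ} (a : Fin m → K) (haO : ∀ j, a j ∈ O) (ha0 : ∀ j, a j ≠ 0) :
    ∃ (R' : Subalgebra k K) (hR'O : R'.toSubring ≤ O.toSubring) (x' : Fin n → K)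
      (hx' : ∀ i, x' i ∈ R'), R ≤ R' ∧ R'.FG ∧ (∀ j, a j ∈ R') ∧ (∀ i, x' i ≠ 0) ∧
      Ideal.span (Set.range fun i => (⟨x' i, hx' i⟩ : R'.toSubring)) =
        Ideal.comap (Subring.inclusion hR'O) (maximalIdeal O) ∧
      (∀ m : Fin n → ℤ, (∏ i, O.valuation (x' i) ^ (m i)) = 1 → m = 0) := by
  classical
  -- numerators and denominators
  have hnd : ∀ j, ∃ num den : K, num ∈ R ∧ den ∈ R ∧ num ≠ 0 ∧ den ≠ 0 ∧ a j = num / den :=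
    fun j => exists_num_den_of_mem_closure R (hfrac (a j)) (ha0 j)
  choose num den hnumR hdenR hnum0 hden0 haeq using hnd
  -- monomialize the numerators, then the denominators
  obtain ⟨R1, hR1O, x1, hx1, hRR1, hfg1, -, hx10, hspan1, hind1, -, hmono1, -⟩ :=
    hS3 k K O n R hRO x hx hfg hx0 hspan hind hr1 m num (fun j => ⟨hnumR j, hnum0 j⟩) 0
      (fun j => Fin.elim0 j) (fun j => Fin.elim0 j)
  obtain ⟨R2, hR2O, x2, hx2, hR1R2, hfg2, -, hx20, hspan2, hind2, hx1x2, hmono2, -⟩ :=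
    hS3 k K O n R1 hR1O x1 hx1 hfg1 hx10 hspan1 hind1 hr1 m den (fun j => ⟨hRR1 (hdenR j), hden0 j⟩)
      0 (fun j => Fin.elim0 j) (fun j => Fin.elim0 j)
  choose α ua huaR1 hua1 hnum using hmono1
  choose β ub hubR2 hub1 hden using hmono2
  choose d hd using hx1x2
  -- numerators as monomials in `x2`
  let α' : Fin m → Fin n → ℕ := fun j i' => ∑ i, α j i * d i i'
  have hnum' : ∀ j, num j = (∏ i, x2 i ^ (α' j i)) * ua j := by
    intro j
    rw [hnum j]
    congr 1
    have h1 : (∏ i, x1 i ^ (α j i)) = ∏ i, (∏ i', x2 i' ^ (d i i')) ^ (α j i) :=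
      Finset.prod_congr rfl fun i _ => by rw [hd i]
    rw [h1]
    simp_rw [← Finset.prod_pow, ← pow_mul]
    rw [Finset.prod_comm]
    refine Finset.prod_congr rfl fun i' _ => ?_
    rw [Finset.prod_pow_eq_pow_sum]
    refine congrArg _ (Finset.sum_congr rfl fun i _ => ?_)
    ring
  -- invert the product of the denominators' units
  set U : K := ∏ j, ub j with hU
  have hUR2 : U ∈ R2 := R2.prod_mem fun j _ => hubR2 j
  have hU1 : O.valuation U = 1 := by
    rw [hU, map_prod]
    exact Finset.prod_eq_one fun j _ => hub1 j
  obtain ⟨R3, hR3O, hx3, hR2R3, hUinv, hfg3, -, hspan3⟩ :=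
    exists_chart_adjoin_inv O R2 hR2O x2 hx2 hfg2 hspan2 hUR2 hU1
  have hub0 : ∀ j, ub j ≠ 0 := fun j h => by
    have := hub1 j; rw [h, map_zero] at this; exact zero_ne_one this
  have hubinv : ∀ j, (ub j)⁻¹ ∈ R3 := by
    intro j
    have hP0 : (∏ j' ∈ Finset.univ.erase j, ub j') ≠ 0 :=
      Finset.prod_ne_zero_iff.mpr fun j' _ => hub0 j'
    have h : (ub j)⁻¹ = U⁻¹ * ∏ j' ∈ Finset.univ.erase j, ub j' := by
      rw [hU, ← Finset.mul_prod_erase _ _ (Finset.mem_univ j), mul_inv, mul_assoc,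
        inv_mul_cancel₀ hP0, mul_one]
    rw [h]
    exact R3.mul_mem hUinv (R3.prod_mem fun j' _ => hR2R3 (hubR2 j'))
  -- the exponent differences have value `≤ 1`
  let h : Fin m → Fin n → ℤ := fun j i => (α' j i : ℤ) - (β j i : ℤ)
  have hv0 : ∀ i, O.valuation (x2 i) ≠ 0 := fun i => (map_ne_zero _).mpr (hx20 i)
  have hah : ∀ j, a j = (∏ i, x2 i ^ (h j i)) * (ua j * (ub j)⁻¹) := by
    intro j
    rw [haeq j, hnum' j, hden j]
    have hsplit : (∏ i, x2 i ^ (h j i)) = (∏ i, x2 i ^ (α' j i)) / ∏ i, x2 i ^ (β j i) := by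
      rw [eq_div_iff (Finset.prod_ne_zero_iff.mpr fun i _ => pow_ne_zero _ (hx20 i)),
        ← Finset.prod_mul_distrib]
      refine Finset.prod_congr rfl fun i _ => ?_
      rw [← zpow_natCast (x2 i) (β j i), ← zpow_add₀ (hx20 i), ← zpow_natCast]
      simp [h]
    rw [hsplit]
    field_simp
  have hhle : ∀ j, (∏ i, O.valuation (x2 i) ^ (h j i)) ≤ 1 := by
    intro j
    have h1 : O.valuation (a j) = ∏ i, O.valuation (x2 i) ^ (h j i) := by
      rw [hah j, map_mul, map_mul, map_inv₀, hua1, hub1, inv_one, mul_one, mul_one, map_prod]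
      exact Finset.prod_congr rfl fun i _ => map_zpow₀ _ _ _
    rw [← h1]
    exact (O.valuation_le_one_iff _).mpr (haO j)
  -- monomialize the differences
  obtain ⟨R4, hR4O, x4, hx4, hR3R4, hfg4, -, hx40, hspan4, hind4, -, -, hexp⟩ :=
    hS3 k K O n R3 hR3O x2 hx3 hfg3 hx20 hspan3 hind2 hr1 0 (fun j => Fin.elim0 j)
      (fun j => Fin.elim0 j) m h hhle
  refine ⟨R4, hR4O, x4, hx4, hRR1.trans (hR1R2.trans (hR2R3.trans hR3R4)), hfg4, fun j => ?_,
    hx40, hspan4, hind4⟩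
  obtain ⟨e, he⟩ := hexp j
  rw [hah j, he]
  exact R4.mul_mem (R4.prod_mem fun i _ => R4.pow_mem (hx4 i) _)
    (R4.mul_mem (hR3R4 (hR2R3 (hR1R2 (huaR1 j)))) (hR3R4 (hubinv j)))

variable
  (hS2 : ∀ p : ℕ, p.Prime → ∀ (k K : Type) [Field k] [CharP k p] [Field K] [Algebra k K] (O : ValuationSubring K), (∀ c : k, algebraMap k K c ∈ O) → (⊤ : IntermediateField k K).FG → (∀ x : K, x ∈ O → ∃ f : Polynomial k, f ≠ 0 ∧ Polynomial.aeval x f ∈ O.nonunits) → ∀ (M : IntermediateField k K), M.FG → Literature.AlgebraicGeometry.Resolution.IsAbhyankarPlace O (algebraMap k K).fieldRange M.toSubfield → Literature.AlgebraicGeometry.Resolution.SeparablyGeneratedOver (Literature.AlgebraicGeometry.Resolution.resField O (algebraMap k K).fieldRange) (Literature.AlgebraicGeometry.Resolution.resField O M.toSubfield) → (∀ z : K, IsAlgebraic M z) → ∃ (n : ℕ) (R : Subalgebra k K) (hRO : R.toSubring ≤ O.toSubring) (x : Fin n → K) (hx : ∀ i, x i ∈ R), R.FG ∧ R ≤ M.toSubalgebra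 ∧ ((M : Set K) ⊆ Subfield.closure (R : Set K)) ∧ (∀ i, x i ≠ 0) ∧ Ideal.span (Set.range fun i => (⟨x i, hx i⟩ : R.toSubring)) = Ideal.comap (Subring.inclusion hRO) (IsLocalRing.maximalIdeal O) ∧ (∀ m : Fin n → ℤ, (∏ i, O.valuation (x i) ^ (m i)) = 1 → m = 0) ∧ IsTranscendenceBasis k x)
  (hS4 : ∀ p : ℕ, p.Prime → ∀ (k K : Type) [Field k] [Field K] [Algebra k K] (O : ValuationSubring K) (n : ℕ) (R : Subalgebra k K) (hRO : R.toSubring ≤ O.toSubring) (x : Fin n → K) (hx : ∀ i, x i ∈ R), R.FG → (∀ i, x i ≠ 0) → Ideal.span (Set.range fun i => (⟨x i, hx i⟩ : R.toSubring)) = Ideal.comap (Subring.inclusion hRO) (IsLocalRing.maximalIdeal O) → (∀ m : Fin n → ℤ, (∏ i, O.valuation (x i) ^ (m i)) = 1 → m = 0) → ∀ (t u : K) (α : Fin n → ℕ), u ∈ R → u⁻¹ ∈ R → O.valuation u = 1 → t ^ p = (∏ i, x i ^ (α i)) * u → (∀ m : Fin n → ℤ, O.valuation t ≠ ∏ i,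 O.valuation (x i) ^ (m i)) → ∃ (R' : Subalgebra k K) (hR'O : R'.toSubring ≤ O.toSubring) (y : Fin n → K) (hy : ∀ i, y i ∈ R'), R ≤ R' ∧ t ∈ R' ∧ R'.FG ∧ ((R' : Set K) ⊆ Subfield.closure ((R : Set K) ∪ {t})) ∧ (∀ i, y i ≠ 0) ∧ Ideal.span (Set.range fun i => (⟨y i, hy i⟩ : R'.toSubring)) = Ideal.comap (Subring.inclusion hR'O) (IsLocalRing.maximalIdeal O) ∧ (∀ m : Fin n → ℤ, (∏ i, O.valuation (y i) ^ (m i)) = 1 → m = 0))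
  (hS5 : ∀ p : ℕ, p.Prime → ∀ (k K : Type) [Field k] [Field K] [Algebra k K] (O : ValuationSubring K) (n : ℕ) (R : Subalgebra k K) (hRO : R.toSubring ≤ O.toSubring) (x : Fin n → K) (hx : ∀ i, x i ∈ R), R.FG → Ideal.span (Set.range fun i => (⟨x i, hx i⟩ : R.toSubring)) = Ideal.comap (Subring.inclusion hRO) (IsLocalRing.maximalIdeal O) → ∀ (t u : K), u ∈ R → O.valuation u = 1 → t ^ p = u → (∀ c : K, c ∈ O → c ∈ Subfield.closure (R : Set K) → O.valuation (u - c ^ p) = 1) → ∃ (R' : Subalgebra k K) (hR'O : R'.toSubring ≤ O.toSubring) (hx' : ∀ i, x i ∈ R'), R ≤ R' ∧ t ∈ R' ∧ R'.FG ∧ ((R' : Set K) ⊆ Subfield.closure ((R : Set K) ∪ {t})) ∧ Ideal.span (Set.range fun i => (⟨x i, hx' i⟩ : R'.toSubring)) = Ideal.comap (Subring.inclusion hR'O) (IsLocalRing.maximalIdeal O))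

include hS2 hS4 hS5

/-! ### The conclusion of the crux -/

omit [Field k] [Field K] [Algebra k K] in
/-- **`LuAlphaPTorsor` along every zero-dimensional RANK-ONE Abhyankar place, every ground field
of characteristic `p`, MODULO the chart stubs S2–S5** (the registered statement of
`stub_rankOneAbhyankar`): a very good chart of `K` (`exists_chart_top`) absorbing the generators
of `A₀` and `t` (`exists_chart_absorbing`) is a finitely generated `A ⊆ O` containing `A₀[t]`,
with `Frac A = K`, regular at the centre (`isRegularLocalRing_of_chart`). The regularity of the
base `A₀` is not used. [folklore] -/
theorem rankOneAbhyankar_of_stubs :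
    ∀ p : ℕ, p.Prime → ∀ (k K : Type) [Field k] [CharP k p] [Field K] [Algebra k K] (O : ValuationSubring K) (A₀ : Subalgebra k K) (h₀ : A₀.toSubring ≤ O.toSubring) (t : K), A₀.FG → t ^ p ∈ A₀ → IsFractionRing (Algebra.adjoin k (insert t (A₀ : Set K))) K → (∀ x : K, x ∈ O → ∃ f : Polynomial k, f ≠ 0 ∧ Polynomial.aeval x f ∈ O.nonunits) → Literature.AlgebraicGeometry.Resolution.IsAbhyankarPlace O (algebraMap k K).fieldRange ⊤ → (∀ z w : K, O.valuation z < 1 → w ≠ 0 → ∃ N : ℕ, O.valuation z ^ N < O.valuation w) → ∃ (A : Subalgebra k K) (h : A.toSubring ≤ O.toSubring), A₀ ≤ A ∧ t ∈ A ∧ A.FG ∧ IsFractionRing A K ∧ IsRegularLocalRing (Localization.AtPrime (Ideal.comap (Subring.inclusion h) (IsLocalRing.maximalIdeal O))) := by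
  intro p hp k K _ _ _ _ O A₀ h₀ t hfg htp hfr hzd hA hr1
  classical
  have hk : ∀ c : k, algebraMap k K c ∈ O := fun c => h₀ (A₀.algebraMap_mem c)
  have htO : t ∈ O := mem_valuationSubring_of_pow_mem O hp.ne_zero (h₀ htp)
  -- generators: `K = k(g ∪ {t})` for algebra generators `g` of `A₀`
  obtain ⟨g, hg⟩ := hfg
  have hgA₀ : ∀ z ∈ g, z ∈ A₀ := fun z hz => by rw [← hg]; exact Algebra.subset_adjoin hz
  set s : Finset K := insert t g with hsdef
  have hs : IntermediateField.adjoin k (s : Set K) = ⊤ := by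
    rw [eq_top_iff]
    intro z _
    haveI := hfr
    obtain ⟨a, b, -, rfl⟩ :=
      IsFractionRing.div_surjective (A := Algebra.adjoin k (insert t (A₀ : Set K))) z
    have hle : Algebra.adjoin k (insert t (A₀ : Set K)) ≤
        (IntermediateField.adjoin k (s : Set K)).toSubalgebra := by
      rw [← hg, Algebra.adjoin_insert_adjoin, hsdef, Finset.coe_insert]
      exact IntermediateField.algebra_adjoin_le_adjoin k _
    exact div_mem (hle a.2) (hle b.2)
  -- a very good chart of `K`
  obtain ⟨n, R, hRO, x, hx, hRfg, hfrac, hx0, hspan, hind, htr⟩ :=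
    exists_chart_top hS2 hS3 hS4 hS5 hp O hk hzd hA hr1 s hs
  -- absorb the non-zero elements of `s`
  set s₁ : Finset K := s.filter fun z => z ≠ 0 with hs₁
  let a : Fin s₁.card → K := fun j => (s₁.equivFin.symm j : K)
  have has₁ : ∀ j, a j ∈ s₁ := fun j => (s₁.equivFin.symm j).2
  have haO : ∀ j, a j ∈ O := fun j => by
    have h := (Finset.mem_filter.mp (has₁ j)).1
    rcases Finset.mem_insert.mp h with h | h
    · rw [h]; exact htO
    · exact h₀ (hgA₀ _ h)
  have ha0 : ∀ j, a j ≠ 0 := fun j => (Finset.mem_filter.mp (has₁ j)).2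
  obtain ⟨A, hAO, x', hx', hRA, hAfg, haA, -, hspanA, -⟩ :=
    exists_chart_absorbing hS3 O hr1 R hRO x hx hRfg hfrac hx0 hspan hind a haO ha0
  -- every element of `s` lies in `A`
  have hsA : ∀ z ∈ s, z ∈ A := by
    intro z hz
    by_cases hz0 : z = 0
    · rw [hz0]; exact A.zero_mem
    · have hz₁ : z ∈ s₁ := Finset.mem_filter.mpr ⟨hz, hz0⟩
      have h := haA (s₁.equivFin ⟨z, hz₁⟩)
      simpa [a] using h
  have hfracA : ∀ z : K, ∃ a' ∈ A.toSubring, ∃ b' ∈ A.toSubring, z = a' / b' := by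
    intro z
    have hz : z ∈ Subfield.closure (A : Set K) := Subfield.closure_mono (fun w hw => hRA hw) (hfrac z)
    obtain ⟨y, hy, w, hw, rfl⟩ := Subfield.mem_closure_iff.mp hz
    have hcl : Subring.closure (A : Set K) = A.toSubring := Subring.closure_eq A.toSubring
    rw [hcl] at hy hw
    exact ⟨y, hy, w, hw, rfl⟩
  haveI hfrA : IsFractionRing A K := isFractionRing_of_forall_exists_div A.toSubring hfracA
  refine ⟨A, hAO, ?_, hsA t (Finset.mem_insert_self t g), hAfg, hfrA, ?_⟩
  · rw [← hg, Algebra.adjoin_le_iff]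
    exact fun z hz => hsA z (Finset.mem_insert_of_mem hz)
  · exact isRegularLocalRing_of_chart k K O hzd n A hAO x' hx' hAfg hfrA hspanA htr

/-- **Relative local uniformization at every zero-dimensional RANK-ONE Abhyankar place, every
ground field of characteristic `p`, MODULO the chart stubs S2–S5**: every finitely generated
`S ⊆ O` is dominated by a finitely generated `A ⊆ O` with `Frac A = K`, regular at the centre of
`O` (the rank-one, zero-dimensional case of Cutkosky 2022, Thm. 1.3, by the Frobenius twist and
very good charts; no completions). [folklore] -/
theorem relLU_zeroDim_rankOne_abhyankar_of_stubs :
    ∀ p : ℕ, p.Prime → ∀ (k K : Type) [Field k] [CharP k p] [Field K] [Algebra k K] (O : ValuationSubring K), (∀ c : k, algebraMap k K c ∈ O) → (⊤ : IntermediateField k K).FG → (∀ x : K, x ∈ O → ∃ f : Polynomial k, f ≠ 0 ∧ Polynomial.aeval x f ∈ O.nonunits) → Literature.AlgebraicGeometry.Resolution.IsAbhyankarPlace O (algebraMap k K).fieldRange ⊤ → (∀ z w : K, O.valuation z < 1 → w ≠ 0 → ∃ N : ℕ, O.valuation z ^ N < O.valuation w) → ∀ (S : Subalgebra k K), S.FG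 → S.toSubring ≤ O.toSubring → ∃ (A : Subalgebra k K) (h : A.toSubring ≤ O.toSubring), S ≤ A ∧ A.FG ∧ IsFractionRing A K ∧ IsRegularLocalRing (Localization.AtPrime (Ideal.comap (Subring.inclusion h) (IsLocalRing.maximalIdeal O))) := by
  intro p hp k K _ _ _ _ O hk htopfg hzd hA hr1 S hSfg hSO
  classical
  obtain ⟨s, hs⟩ := htopfg
  obtain ⟨g, hg⟩ := hSfg
  have hgS : ∀ z ∈ g, z ∈ S := fun z hz => by rw [← hg]; exact Algebra.subset_adjoin hz
  -- a very good chart of `K`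
  obtain ⟨n, R, hRO, x, hx, hRfg, hfrac, hx0, hspan, hind, htr⟩ :=
    exists_chart_top hS2 hS3 hS4 hS5 hp O hk hzd hA hr1 s hs
  -- absorb the non-zero generators of `S`
  set g₁ : Finset K := g.filter fun z => z ≠ 0 with hg₁
  let a : Fin g₁.card → K := fun j => (g₁.equivFin.symm j : K)
  have hag₁ : ∀ j, a j ∈ g₁ := fun j => (g₁.equivFin.symm j).2
  have haO : ∀ j, a j ∈ O := fun j => hSO (hgS _ (Finset.mem_filter.mp (hag₁ j)).1)
  have ha0 : ∀ j, a j ≠ 0 := fun j => (Finset.mem_filter.mp (hag₁ j)).2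
  obtain ⟨A, hAO, x', hx', hRA, hAfg, haA, -, hspanA, -⟩ :=
    exists_chart_absorbing hS3 O hr1 R hRO x hx hRfg hfrac hx0 hspan hind a haO ha0
  have hgA : ∀ z ∈ g, z ∈ A := by
    intro z hz
    by_cases hz0 : z = 0
    · rw [hz0]; exact A.zero_mem
    · have hz₁ : z ∈ g₁ := Finset.mem_filter.mpr ⟨hz, hz0⟩
      have h := haA (g₁.equivFin ⟨z, hz₁⟩)
      simpa [a] using h
  have hfracA : ∀ z : K, ∃ a' ∈ A.toSubring, ∃ b' ∈ A.toSubring, z = a' / b' := by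
    intro z
    have hz : z ∈ Subfield.closure (A : Set K) := Subfield.closure_mono (fun w hw => hRA hw) (hfrac z)
    obtain ⟨y, hy, w, hw, rfl⟩ := Subfield.mem_closure_iff.mp hz
    have hcl : Subring.closure (A : Set K) = A.toSubring := Subring.closure_eq A.toSubring
    rw [hcl] at hy hw
    exact ⟨y, hy, w, hw, rfl⟩
  haveI hfrA : IsFractionRing A K := isFractionRing_of_forall_exists_div A.toSubring hfracA
  refine ⟨A, hAO, ?_, hAfg, hfrA, isRegularLocalRing_of_chart k K O hzd n A hAO x' hx' hAfg hfrA hspanA htr⟩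
  rw [← hg, Algebra.adjoin_le_iff]
  exact fun z hz => hgA z hz

end Stubs

/-! ### The registered stubs S6, discharged -/

/-- **S6 `stub_rankOneAbhyankar` — `LuAlphaPTorsor` along every ZERO-DIMENSIONAL RANK-ONE
Abhyankar place, every ground field of characteristic `p`, UNCONDITIONALLY** (reshape v6 of the
line `pfaff-line-log-final-forms`, lead seat c4): the assembly `rankOneAbhyankar_of_stubs` fed
with the landed stubs S2 `stub_henselRootChart`, S3 `stub_perronMonomialization`, S4
`stub_valueStep`, S5 `stub_residueStep` (S1 `stub_frobeniusTwistSeparable` enters through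
`exists_chart_top`). This is the rank-one case of Cutkosky 2022, Thm. 1.3 for the crux, with a
completion-free proof (Frobenius twist + very good charts); the named fact `Cutkosky2022_Thm13`
is not used. [cite: Cutkosky2022, Thm. 1.3 (statement only; independent proof)] -/
theorem stub_rankOneAbhyankar :
    ∀ p : ℕ, p.Prime → ∀ (k K : Type) [Field k] [CharP k p] [Field K] [Algebra k K] (O : ValuationSubring K) (A₀ : Subalgebra k K) (h₀ : A₀.toSubring ≤ O.toSubring) (t : K), A₀.FG → t ^ p ∈ A₀ → IsFractionRing (Algebra.adjoin k (insert t (A₀ : Set K))) K → (∀ x : K, x ∈ O → ∃ f : Polynomial k, f ≠ 0 ∧ Polynomial.aeval x f ∈ O.nonunits) → Literature.AlgebraicGeometry.Resolution.IsAbhyankarPlace O (algebraMap k K).fieldRange ⊤ → (∀ z w : K, O.valuation z < 1 → w ≠ 0 → ∃ N : ℕ, O.valuation z ^ N < O.valuation w) → ∃ (A : Subalgebra k K) (h : A.toSubring ≤ O.toSubring), A₀ ≤ A ∧ t ∈ A ∧ A.FG ∧ IsFractionRing A K ∧ IsRegularLocalRing (Localization.AtPrime (Ideal.comap (Subring.inclusion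 h) (IsLocalRing.maximalIdeal O))) :=
  rankOneAbhyankar_of_stubs stub_perronMonomialization stub_henselRootChart stub_valueStep
    stub_residueStep

/-- **Relative local uniformization at every zero-dimensional RANK-ONE Abhyankar place of a
function field over ANY ground field of characteristic `p`**, unconditionally: every finitely
generated `S ⊆ O` is dominated by a finitely generated `A ⊆ O` with `Frac A = K`, regular at the
centre of `O`. [cite: Cutkosky2022, Thm. 1.3 (statement only; independent proof)] -/
theorem relLU_zeroDim_rankOne_abhyankar :
    ∀ p : ℕ, p.Prime → ∀ (k K : Type) [Field k] [CharP k p] [Field K] [Algebra k K] (O : ValuationSubring K), (∀ c : k, algebraMap k K c ∈ O) → (⊤ : IntermediateField k K).FG → (∀ x : K, x ∈ O → ∃ f : Polynomial k, f ≠ 0 ∧ Polynomial.aeval x f ∈ O.nonunits) → Literature.AlgebraicGeometry.Resolution.IsAbhyankarPlace O (algebraMap k K).fieldRange ⊤ → (∀ z w : K, O.valuation z < 1 → w ≠ 0 → ∃ N : ℕ, O.valuation z ^ N < O.valuation w) → ∀ (S : Subalgebra k K), S.FG → S.toSubring ≤ O.toSubring → ∃ (A : Subalgebra k K) (h : A.toSubring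 ≤ O.toSubring), S ≤ A ∧ A.FG ∧ IsFractionRing A K ∧ IsRegularLocalRing (Localization.AtPrime (Ideal.comap (Subring.inclusion h) (IsLocalRing.maximalIdeal O))) :=
  relLU_zeroDim_rankOne_abhyankar_of_stubs stub_perronMonomialization stub_henselRootChart
    stub_valueStep stub_residueStep

end Summit.ResolutionOfSingularities.ResolutionOfSingularities.Theorems.PfaffLine
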